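import Summits.ResolutionOfSingularities.ResolutionOfSingularities.Theorems.FrobeniusClosingSteerWords29PointTailPersist
import Summits.ResolutionOfSingularities.ResolutionOfSingularities.Theorems.FrobeniusClosingSteerPointStepsRecur

/-!
# Crux `Steer` (stmt-ResolutionOfSingularities-16345), line `switching-dichotomy` — WORDS 30: the (Σ) LEAF `PointStepsRecurTwoN` HOLDS (res-type-028) and §σ2.28 (g)+(g′)+(g″) r41 — (Par-S) ⟸ hNS ∧ hARᵒ ∧ hK4′ (the arithmetic-switch vocabulary `ArithBinaryResidueAt` / `ArithSwitchClause` / `OddCleanedPointStepAt` …, parity glue) (HOIST of the registered skeleton r52 5a09c4c2f84a0135, l.1947–2016,2017–2221, inside `section HeightSplitTwo` with its `variable {K : Type} [Field K]`)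

Holder res-L0-w41-lead-1 g6 on res-L0-w41-plan-1 RULING 47 (E1) / 104b; see `…Words01Core` for the hoist protocol (bodies byte for byte;
`[cite: …]` / `[folklore]` tags on CLOSED `def … : Prop` words are written «(ref. …)» / «(folklore)» — GATE NOTE of `…Words02Stubs`;
cite keys inside `[cite:]` tags normalised to `references.bib` keys where needed, as in `…Words03Phases`).
Nothing here is a statement of the manuscript [claim: Hironaka2017, status: under-review]. OURS (candidates / vocabulary; AI review is
weaker than expert review).
-/

open Summit.ResolutionOfSingularities.ResolutionOfSingularities.Theses.FrobeniusClosing (IsolatedForcedTermination)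
open Literature.AlgebraicGeometry.Resolution (IsAbhyankarPlace FGOver exists_ringKrullDim_eq_and_trdeg_eq
  trdeg_eq_trdeg_of_isFractionRing locAtCentre IsQuadraticTransformAlong SubringDominates IsRsopPart
  LocalUniformization3 RelLocalUniformization CossartPiltant2019General)
open Summit.ResolutionOfSingularities.ResolutionOfSingularities.Theorems.SteerRankThinness
  (HasProperCoarsening concl_of_hasProperCoarsening rankOne_of_not_hasProperCoarsening)
open Summit.ResolutionOfSingularities.ResolutionOfSingularities.Theorems.PfaffLine

set_option linter.dupNamespace false

namespace Summit.ResolutionOfSingularities.ResolutionOfSingularities.Theorems.SwitchingDichotomy.Words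

section SteeredTwo

open IsLocalRing
open Literature.AlgebraicGeometry.Resolution (IsLocalBlowupAlong IsQuadraticTransform IsExcellentRing)

variable {K : Type} [Field K]


/-! #### (Σ) LEAF — `PointStepsRecurTwoN` HOLDS (res-type-028 g10; res-L0-w41-plan-1 RULINGS 110b / 111a (2) / 117; statement owner res-D-pv-011,
body e16041012b506916). Feeds the WORK binder `hrecur` of the T-line (`eternalSteeredRunTwo_of_slate10'` / `…slate11'`) from the TREE theorem
`SwitchingDichotomy.PointStepsRecur.pointSteps_recur_of_steeredRun` (p530614 ✓, `Theorems/FrobeniusClosingSteerPointStepsRecur.lean`): an eternal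
divisor tail of a steered `CoreDatum 2 4` run lives in ONE fixed regular excellent member, where the telescoped Frobenius chain makes the radicand a
square (Frobenius-closedness in the completion) — contradicting run hygiene. Only `core`, `hR0`, `hrun`, `¬ HeightTwoStepsInfinite` are used; the
binders ¬HasProperCoarsening / NormalAt / no-dominant-tail / eventually-HIGH / pos-steps-infinite are idle. PASTE: anywhere after `HeightTwoStepsInfinite`
(e.g. right before `end HeightSplitTwo`); REQUIRES `import Summits.ResolutionOfSingularities.ResolutionOfSingularities.Theorems.FrobeniusClosingSteerPointStepsRecur`.
0 sorries in this block. -/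

/-- **(Σ) · `PointStepsRecurTwoN` holds** (its body VERBATIM as the type; `:= pointStepsRecurTwoN_holds` also inhabits `PointStepsRecurTwoN` where that
`def` is pasted): along an eternal σ_top-steered run of a `CoreDatum 2 4` datum with only finitely many positive steps of height `≥ 2`, point steps
recur. By the tree theorem `PointStepsRecur.pointSteps_recur_of_steeredRun` (p530614). OURS. [folklore] -/
theorem pointStepsRecurTwoN_holds : ∀ p : ℕ, p = 2 →
      ∀ (k K : Type) [Field k] [CharP k p] [PerfectField k] [Field K] [Algebra k K]
      (O : ValuationSubring K) (A₀ : Subalgebra k K) (h₀ : A₀.toSubring ≤ O.toSubring) (t : K),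
      CoreDatum p 4 k K O A₀ h₀ t → ¬ HasProperCoarsening O →
      ∀ (R : ℕ → Subring K) (P : (i : ℕ) → Ideal (R i)) (s : ℕ → K),
        R 0 = locAtCentre A₀.toSubring O → NormalAt O (R 0) p t → IsSteeredRun O R P t p s →
        (¬ ∃ i₀ c : ℕ, 1 ≤ c ∧ IsDominantTail R P i₀ c) →
        (∃ i₀ : ℕ, ∀ i, i₀ ≤ i → IsHighOrderAt R s p i) →
        ¬ HeightTwoStepsInfinite R P → {j | IsPosStep R P j}.Infinite →
        ∀ i₀ : ℕ, ∃ i, i₀ ≤ i ∧ IsPointStep R P i := by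
  intro p hp k K _ _ _ _ _ O A₀ h₀ t core _ R P s hR0 _ hrun _ _ hfin _ i₀
  subst hp
  exact _root_.Summit.ResolutionOfSingularities.ResolutionOfSingularities.Theorems.SwitchingDichotomy.PointStepsRecur.pointSteps_recur_of_steeredRun
    O A₀ h₀ t core R P s hR0 hrun hfin i₀

/-- **T-line with (Σ) DISCHARGED** (r38's `eternalSteeredRunTwo_of_slate10'` fed `pointStepsRecurTwoN_holds`; 9 binders):
T ⇐ FRONTIER {F-A1-toric `hB₂`, F-A2-toric `hC₂`, (Par-S) `hFBs`, G-TAME(4)₂ `hG4`, W(3)₂ `hW3`} · RUNG {G-perf(3)₂ `hG3`} · WORK {D3a `hD3a`} ·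
FACTS {hL′, hCP′}. Pure logic. OURS. [folklore] -/
theorem eternalSteeredRunTwo_of_slate10'_sigma
    (hFBs : StrippingTailSwitchingConclTwoN)
    (hB₂ : BirthWanderHighConclTwoN) (hC₂ : BranchWanderHighConclTwoN)
    (hG4 : ∀ e : ℕ, 2 ≤ e → NoEternalConstOrderIsolatedChainPerfect 2 4 (2 * e))
    (hG3 : ∀ e : ℕ, 2 ≤ e → NoEternalConstOrderIsolatedChainPerfect 2 3 (2 * e))
    (hW3 : ∀ e : ℕ, 2 ≤ e → NoEternalConstOrderIsolatedChainImperfect 2 3 (2 * e))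
    (hD3a : LowTowerExistsTwo)
    (hL' : Literature.AlgebraicGeometry.Resolution.Lipman1978NoEternalNormalisedBranch.{0})
    (hCP' : Literature.AlgebraicGeometry.Resolution.CossartPiltant2019LocalPermissible.{0}) : EternalSteeredRunTwo :=
  eternalSteeredRunTwo_of_slate10' pointStepsRecurTwoN_holds hFBs hB₂ hC₂ hG4 hG3 hW3 hD3a hL' hCP'


/-- **THE T-LINE OF RECORD (r39)** — res-L0-w41-strat-2's `eternalSteeredRunTwo_of_slate11'` ((e-V) architecture: hG4 OFF the T-line; hΘ ↦ (Σ) + (e2))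
with hrecur FED BY NAME (`pointStepsRecurTwoN_holds`, res-type-028), hPT FED BY NAME (`pointTailPersistTwoN_holds`, res-D-pv-011):
T ⇐ FRONTIER {F-A1-toric `hB₂`, F-A2-toric `hC₂`, (Par-S) `hFBs`, W(3)₂ `hW3`} · RUNG {G-perf(3)₂ `hG3`} · WORK {
hNT4 `NoTangentialStepPerfect 2 4` (res-D-pv-004), D3a `hD3a` (res-L0-w41-stub-3)} · FACTS {hL′, hCP′}. 9 binders. Pure logic. OURS. [folklore] -/
theorem eternalSteeredRunTwo_of_slate11'''
        (hNT4 : ∀ e : ℕ, 2 ≤ e → NoTangentialStepPerfect 2 4 (2 * e))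
    (hFBs : StrippingTailSwitchingConclTwoN)
    (hB₂ : BirthWanderHighConclTwoN) (hC₂ : BranchWanderHighConclTwoN)
    (hG3 : ∀ e : ℕ, 2 ≤ e → NoEternalConstOrderIsolatedChainPerfect 2 3 (2 * e))
    (hW3 : ∀ e : ℕ, 2 ≤ e → NoEternalConstOrderIsolatedChainImperfect 2 3 (2 * e))
    (hD3a : LowTowerExistsTwo)
    (hL' : Literature.AlgebraicGeometry.Resolution.Lipman1978NoEternalNormalisedBranch.{0})
    (hCP' : Literature.AlgebraicGeometry.Resolution.CossartPiltant2019LocalPermissible.{0}) : EternalSteeredRunTwo :=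
  eternalSteeredRunTwo_of_slate11' pointStepsRecurTwoN_holds pointTailPersistTwoN_holds hNT4 hFBs hB₂ hC₂ hG3 hW3 hD3a hL' hCP'

/-- **THE T-LINE WITH D3a DISCHARGED** (r39 + res-L0-w41-stub-3's hD3a LEAF `lowTowerExistsTwo_holds`; plan-1 RULING 127a): `eternalSteeredRunTwo_of_slate11'''`
with hD3a FED BY NAME. T ⇐ FRONTIER {F-A1-toric `hB₂`, F-A2-toric `hC₂`, (Par-S) `hFBs`, W(3)₂ `hW3`} · RUNG {G-perf(3)₂ `hG3`} · WORK {hNT4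
`NoTangentialStepPerfect 2 4` (res-D-pv-004)} · FACTS {hL′, hCP′}. 8 binders. Pure logic. OURS. [folklore] -/
theorem eternalSteeredRunTwo_of_slate11''''
    (hNT4 : ∀ e : ℕ, 2 ≤ e → NoTangentialStepPerfect 2 4 (2 * e))
    (hFBs : StrippingTailSwitchingConclTwoN)
    (hB₂ : BirthWanderHighConclTwoN) (hC₂ : BranchWanderHighConclTwoN)
    (hG3 : ∀ e : ℕ, 2 ≤ e → NoEternalConstOrderIsolatedChainPerfect 2 3 (2 * e))
    (hW3 : ∀ e : ℕ, 2 ≤ e → NoEternalConstOrderIsolatedChainImperfect 2 3 (2 * e))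
    (hL' : Literature.AlgebraicGeometry.Resolution.Lipman1978NoEternalNormalisedBranch.{0})
    (hCP' : Literature.AlgebraicGeometry.Resolution.CossartPiltant2019LocalPermissible.{0}) : EternalSteeredRunTwo :=
  eternalSteeredRunTwo_of_slate11''' hNT4 hFBs hB₂ hC₂ hG3 hW3 lowTowerExistsTwo_holds hL' hCP'


/-! #### §σ2.28 (g)+(g′)+(g″) r41 — (Par-S) ⟸ hNS (FRONTIER) ∧ hARᵒ (WORK, tri-2 F1 VERBATIM) ∧ hK4′ «hNS → K4♯» (FRONTIER modulo the β-line,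
RULING 135) ∧ hEv (FRONTIER) — res-L0-w41-strat-2 g2 pen on plan-1 RULINGS 118c/123b/126a/128/135b/137: (g′1) REVERTS to tri-2 F1 VERBATIM (the A-stage
clause binder of RULING 128 EDIT 1 is idle — tri-1 P5: A8 is not consumed by A7) and hNS is consumed where it bites, by the WEAKENED binder
`hK4′ : NoCompanionSingularSurfaceTwoN → StrippingTailSwitchingArithConclTwoN` (res-L0-w41-idea-1's β-theorem leaf `hK4_of_beta`, debts K-β1/2/4); hNS text =
r40's registered (g″0)/(g″1) UNCHANGED (RULING 137: tri-1 C1 = NO, coheight form kept) + tri-1's 135c(iii) sentence. Words: tri-1 A7 (`v610/ArithWord.lean`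
53185a2f9b17b242), tri-2 F1 (`s28g/ParityCut-tri2.r38.delta.lean` da6c4556ac68225f), strat-2 (g) c2e7d28d7dc96f24 / (g″) 148fdd4aaa570197; cut against r40
c28bee1e838a4877 + res-L0-w41-stub-3's certified leaf swap (fe2f47064a0617f5); rationale STRAT2-MEMO-1 §14/§16. BOOK (plan-1 136/137): FRONTIER {hB₂ᵗ, hC₂ᵗ,
hK4′, hEv, hNS, hW3} · WORK {hG3 (direct: Lemma S₃ + F♭), hNT4, hARᵒ} · FACTS {hL′, hCP′}. OURS; candidates, not facts. -/

/-- **(g0) · ArithBinaryResidueAt** (tri-1 A7, VERBATIM `v610/ArithWord.lean` 53185a2f9b17b242): stage `i` is a POINT step with CLEANED tangent form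
binary of degree `d` (`s i ^ p − g² − Ψ(m₁, m₂) ∈ 𝔪^(d+1)`, `(m₁, m₂)` part of a r.s.o.p., `Ψ` homogeneous of degree `d`) whose reduction over `κ_i`
has NO zero on `κ_i² ∖ 0`. OURS. [folklore] -/
def ArithBinaryResidueAt (R : ℕ → Subring K) (P : (i : ℕ) → Ideal (R i)) (s : ℕ → K) (p d i : ℕ) : Prop :=
  IsPointStep R P i ∧
    ∃ (_ : IsLocalRing (R i)) (hs : s i ^ p ∈ R i) (g m₁ m₂ : R i) (Ψ : MvPolynomial (Fin 2) (R i)),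
      IsRsopPart ![m₁, m₂] ∧ Ψ.IsHomogeneous d ∧
      (⟨s i ^ p, hs⟩ : R i) - g ^ 2 - MvPolynomial.eval ![m₁, m₂] Ψ ∈ maximalIdeal (R i) ^ (d + 1) ∧
      ∀ a b : ResidueField (R i), (a ≠ 0 ∨ b ≠ 0) →
        MvPolynomial.eval ![a, b] (MvPolynomial.map (residue (R i)) Ψ) ≠ 0

/-- **(g0) · ArithSwitchClause** (tri-1 A7, VERBATIM): «arithmetic binary residue infinitely often» — one odd `d ≥ 3` and, beyond every stage, a point
step with an arithmetic binary residue of degree `d`. OURS. [folklore] -/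
def ArithSwitchClause (R : ℕ → Subring K) (P : (i : ℕ) → Ideal (R i)) (s : ℕ → K) (p : ℕ) : Prop :=
  ∃ d : ℕ, Odd d ∧ 3 ≤ d ∧ ∀ i₀ : ℕ, ∃ i, i₀ ≤ i ∧ ArithBinaryResidueAt R P s p d i

/-- **(g′0) · OddCleanedPointStepAt** (tri-2 F1 VERBATIM): stage `i` is a POINT step whose CLEANED order is an odd `d`. OURS. [folklore] -/
def OddCleanedPointStepAt (R : ℕ → Subring K) (P : (i : ℕ) → Ideal (R i)) (s : ℕ → K) (p i : ℕ) : Prop :=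
  IsPointStep R P i ∧
    ∃ (_ : IsLocalRing (R i)) (hs : s i ^ p ∈ R i) (d : ℕ), Odd d ∧
      (∃ g : R i, (⟨s i ^ p, hs⟩ : R i) - g ^ p ∈ maximalIdeal (R i) ^ d) ∧
      ∀ h : R i, (⟨s i ^ p, hs⟩ : R i) - h ^ p ∉ maximalIdeal (R i) ^ (d + 1)

/-- **(g″0) · NoSingularSurfaceAt** (tri-1 A8 `NoSingularSurfaceAtA` clause «dim_c V(∇f_i) ≤ 1», typed with §3.2's `IsSingPrime`; RULING 128: KEPT):
every singular prime `Q` of the radicand `s i ^ p ∈ R i` has `dim (R i ⧸ Q) ≤ 1` — no singular SURFACE (or 3-fold) of `T ^ p = s i ^ p` passes through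
the centre (read ONLY at odd-cleaned-order point steps = A-stages: at B-stages `f_B = u_A · G_B` carries the fresh singular surfaces `V(u_A, G_B) ∋ c_B`,
tri-2 NOTE 12:49:11Z, which die at the next A-stage). OURS. [folklore] -/
def NoSingularSurfaceAt (R : ℕ → Subring K) (s : ℕ → K) (p i : ℕ) : Prop :=
  ∀ (hs : s i ^ p ∈ R i) (Q : Ideal (R i)) [Q.IsPrime], IsSingPrime (R i) p ⟨s i ^ p, hs⟩ Q → ringKrullDim (R i ⧸ Q) ≤ 1

/-- **(g″1) hNS · NoCompanionSingularSurfaceTwoN** (FRONTIER; RULINGS 126a/128 EDIT 3; tri-1 (R7) «stay» family / A8 (L-top) PLAUSIBLE, NOT DISCHARGED):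
in a (Par-S) tail ((Par-S) binders VERBATIM), EVENTUALLY no singular surface passes through the centre AT A-STAGES (odd-cleaned-order point steps) — the
PERSISTENT-companion residual in typeable form (fresh B-stage surfaces die at the next A-stage). Why it might fail: a singular `W ⊆ Sing` is never
σ_top-permissible and never modified at its generic point, so the centres may follow `W̃` forever (RULING 124b: possibly a STEERING residual,
dischargeable only by a σ_top amendment — priced in STRAT2-MEMO-1 §16, not executed). Relay remark (res-L0-w41-tri-1, RULING 135c(iii)): «at an A-stage (binary square-free Ψ) no companion lies inside an
exceptional divisor through c: ∇g ⊆ (x, φ) forces φ̄(0,z,w) ∣ gcd(Ψ_Z, Ψ_W) + h.o.t., a unit»; late odd-cleaned point steps ARE the A-stages (tri-1 C1 = NO,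
RULING 137), so the guard `OddCleanedPointStepAt` is exact. Consumed ONLY through hK4′ (the β-line, K-β5 «eventually ALL A-stages»). OURS. (folklore) -/
def NoCompanionSingularSurfaceTwoN : Prop :=
  ∀ p : ℕ, p = 2 →
    ∀ (k K : Type) [Field k] [CharP k p] [PerfectField k] [Field K] [Algebra k K]
    (O : ValuationSubring K) (A₀ : Subalgebra k K) (h₀ : A₀.toSubring ≤ O.toSubring) (t : K),
    CoreDatum p 4 k K O A₀ h₀ t → ¬ HasProperCoarsening O →
    ∀ (R : ℕ → Subring K) (P : (i : ℕ) → Ideal (R i)) (s : ℕ → K),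
      R 0 = locAtCentre A₀.toSubring O → NormalAt O (R 0) p t → IsSteeredRun O R P t p s →
      (¬ ∃ i₀ c : ℕ, 1 ≤ c ∧ IsDominantTail R P i₀ c) →
      (∃ i₀ : ℕ, ∀ i, i₀ ≤ i → IsHighOrderAt R s p i) →
      ¬ HeightTwoStepsInfinite R P → {j | IsPosStep R P j}.Infinite →
      (∀ i₀ : ℕ, ∃ i, i₀ ≤ i ∧ IsPointStep R P i ∧
        ∀ hs : s i ^ p ∈ R i, ¬ HasIsolatedSingularity (RadicandRing (R i) p ⟨s i ^ p, hs⟩)) →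
      (¬ ∃ i₀ : ℕ, ∃ x : K, x ≠ 0 ∧ x ∈ O ∧ O.valuation x < 1 ∧
        ∀ i, i₀ ≤ i → ∀ y ∈ R i, O.valuation y < 1 → ∃ j, i < j ∧ y / x ∈ R j) →
      ∃ i₀ : ℕ, ∀ i, i₀ ≤ i → OddCleanedPointStepAt R P s p i → NoSingularSurfaceAt R s p i

/-- **(g1) K4♯ · StrippingTailSwitchingArithConclTwoN** (FRONTIER «no eternal ARITHMETIC binary residue»; RULINGS 115a/118c/123b; strat-2 (g) VERBATIM):
(Par-S) binders + `ArithSwitchClause` ⇒ `Concl`. Vacuous when no `κ_i` has an odd-degree separable extension (`k = k̄`: 072). Why it might fail: a perfect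
non-closed `k` re-creating a rootless odd binary residue forever (tri-1 bench b4). OURS. (folklore) -/
def StrippingTailSwitchingArithConclTwoN : Prop :=
  ∀ p : ℕ, p = 2 →
    ∀ (k K : Type) [Field k] [CharP k p] [PerfectField k] [Field K] [Algebra k K]
    (O : ValuationSubring K) (A₀ : Subalgebra k K) (h₀ : A₀.toSubring ≤ O.toSubring) (t : K),
    CoreDatum p 4 k K O A₀ h₀ t → ¬ HasProperCoarsening O →
    ∀ (R : ℕ → Subring K) (P : (i : ℕ) → Ideal (R i)) (s : ℕ → K),
      R 0 = locAtCentre A₀.toSubring O → NormalAt O (R 0) p t → IsSteeredRun O R P t p s →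
      (¬ ∃ i₀ c : ℕ, 1 ≤ c ∧ IsDominantTail R P i₀ c) →
      (∃ i₀ : ℕ, ∀ i, i₀ ≤ i → IsHighOrderAt R s p i) →
      ¬ HeightTwoStepsInfinite R P → {j | IsPosStep R P j}.Infinite →
      (∀ i₀ : ℕ, ∃ i, i₀ ≤ i ∧ IsPointStep R P i ∧
        ∀ hs : s i ^ p ∈ R i, ¬ HasIsolatedSingularity (RadicandRing (R i) p ⟨s i ^ p, hs⟩)) →
      (¬ ∃ i₀ : ℕ, ∃ x : K, x ≠ 0 ∧ x ∈ O ∧ O.valuation x < 1 ∧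
        ∀ i, i₀ ≤ i → ∀ y ∈ R i, O.valuation y < 1 → ∃ j, i < j ∧ y / x ∈ R j) →
      ArithSwitchClause R P s p →
      Concl O A₀ t

/-- **(g2) un-cut ARITH-REDUCTION · StrippingTailSwitchingArithTwoN** (strat-2 (g) VERBATIM; RULING 123a: as typed it silently carries (Iso-S) — kept
only as the STRONGER word feeding (g′4); the WORK word is (g′1)). OURS. (folklore) -/
def StrippingTailSwitchingArithTwoN : Prop :=
  ∀ p : ℕ, p = 2 →
    ∀ (k K : Type) [Field k] [CharP k p] [PerfectField k] [Field K] [Algebra k K]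
    (O : ValuationSubring K) (A₀ : Subalgebra k K) (h₀ : A₀.toSubring ≤ O.toSubring) (t : K),
    CoreDatum p 4 k K O A₀ h₀ t → ¬ HasProperCoarsening O →
    ∀ (R : ℕ → Subring K) (P : (i : ℕ) → Ideal (R i)) (s : ℕ → K),
      R 0 = locAtCentre A₀.toSubring O → NormalAt O (R 0) p t → IsSteeredRun O R P t p s →
      (¬ ∃ i₀ c : ℕ, 1 ≤ c ∧ IsDominantTail R P i₀ c) →
      (∃ i₀ : ℕ, ∀ i, i₀ ≤ i → IsHighOrderAt R s p i) →
      ¬ HeightTwoStepsInfinite R P → {j | IsPosStep R P j}.Infinite →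
      (∀ i₀ : ℕ, ∃ i, i₀ ≤ i ∧ IsPointStep R P i ∧
        ∀ hs : s i ^ p ∈ R i, ¬ HasIsolatedSingularity (RadicandRing (R i) p ⟨s i ^ p, hs⟩)) →
      (¬ ∃ i₀ : ℕ, ∃ x : K, x ≠ 0 ∧ x ∈ O ∧ O.valuation x < 1 ∧
        ∀ i, i₀ ≤ i → ∀ y ∈ R i, O.valuation y < 1 → ∃ j, i < j ∧ y / x ∈ R j) →
      ArithSwitchClause R P s p

/-- **(g′1) hARᵒ · StrippingTailSwitchingOddArithTwoN** (WORK; r41 = res-L0-w41-tri-2 F1 VERBATIM, RULING 135b: the A-stage clause binder of r40 was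
idle and is DROPPED; kernel hand res-type-062 `hAR-BLUEPRINT.md` b05763b89178e0bc, STAGE 1 `ArithReduction.arithSwitchClause_of_bricks_run` p533179 ✓, slot H1
re-cut to res-L0-w41-tri-1's member-datum words `VisitLawAt` / `EventuallyConstantReducedOrder` (RULING 137a)): (Par-S) binders + «odd cleaned-order point steps
i.o.» ⇒ `ArithSwitchClause`. OURS. (folklore) -/
def StrippingTailSwitchingOddArithTwoN : Prop :=
  ∀ p : ℕ, p = 2 →
    ∀ (k K : Type) [Field k] [CharP k p] [PerfectField k] [Field K] [Algebra k K]
    (O : ValuationSubring K) (A₀ : Subalgebra k K) (h₀ : A₀.toSubring ≤ O.toSubring) (t : K),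
    CoreDatum p 4 k K O A₀ h₀ t → ¬ HasProperCoarsening O →
    ∀ (R : ℕ → Subring K) (P : (i : ℕ) → Ideal (R i)) (s : ℕ → K),
      R 0 = locAtCentre A₀.toSubring O → NormalAt O (R 0) p t → IsSteeredRun O R P t p s →
      (¬ ∃ i₀ c : ℕ, 1 ≤ c ∧ IsDominantTail R P i₀ c) →
      (∃ i₀ : ℕ, ∀ i, i₀ ≤ i → IsHighOrderAt R s p i) →
      ¬ HeightTwoStepsInfinite R P → {j | IsPosStep R P j}.Infinite →
      (∀ i₀ : ℕ, ∃ i, i₀ ≤ i ∧ IsPointStep R P i ∧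
        ∀ hs : s i ^ p ∈ R i, ¬ HasIsolatedSingularity (RadicandRing (R i) p ⟨s i ^ p, hs⟩)) →
      (¬ ∃ i₀ : ℕ, ∃ x : K, x ≠ 0 ∧ x ∈ O ∧ O.valuation x < 1 ∧
        ∀ i, i₀ ≤ i → ∀ y ∈ R i, O.valuation y < 1 → ∃ j, i < j ∧ y / x ∈ R j) →
      (∀ i₀ : ℕ, ∃ i, i₀ ≤ i ∧ OddCleanedPointStepAt R P s p i) →
      ArithSwitchClause R P s p

/-- **(g′2) hEv (Iso-S) · StrippingTailSwitchingEvenConclTwoN** (FRONTIER until owned; tri-2 F1 VERBATIM per RULING 128 EDIT 2 — it carries its own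
geometric part; candidate WORK route = 062's (ρ1) ∘ idea-3's even tangential normal form, tri-1 123c audit pending): (Par-S) binders + «eventually no
odd cleaned-order point step» ⇒ `Concl`. Why it might fail: the rootless EVEN residue `H₀` i.o. over a non-closed `k`; a persistent companion singular
surface/curve with tangential steps i.o. OURS. (folklore) -/
def StrippingTailSwitchingEvenConclTwoN : Prop :=
  ∀ p : ℕ, p = 2 →
    ∀ (k K : Type) [Field k] [CharP k p] [PerfectField k] [Field K] [Algebra k K]
    (O : ValuationSubring K) (A₀ : Subalgebra k K) (h₀ : A₀.toSubring ≤ O.toSubring) (t : K),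
    CoreDatum p 4 k K O A₀ h₀ t → ¬ HasProperCoarsening O →
    ∀ (R : ℕ → Subring K) (P : (i : ℕ) → Ideal (R i)) (s : ℕ → K),
      R 0 = locAtCentre A₀.toSubring O → NormalAt O (R 0) p t → IsSteeredRun O R P t p s →
      (¬ ∃ i₀ c : ℕ, 1 ≤ c ∧ IsDominantTail R P i₀ c) →
      (∃ i₀ : ℕ, ∀ i, i₀ ≤ i → IsHighOrderAt R s p i) →
      ¬ HeightTwoStepsInfinite R P → {j | IsPosStep R P j}.Infinite →
      (∀ i₀ : ℕ, ∃ i, i₀ ≤ i ∧ IsPointStep R P i ∧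
        ∀ hs : s i ^ p ∈ R i, ¬ HasIsolatedSingularity (RadicandRing (R i) p ⟨s i ^ p, hs⟩)) →
      (¬ ∃ i₀ : ℕ, ∃ x : K, x ≠ 0 ∧ x ∈ O ∧ O.valuation x < 1 ∧
        ∀ i, i₀ ≤ i → ∀ y ∈ R i, O.valuation y < 1 → ∃ j, i < j ∧ y / x ∈ R j) →
      (∃ i₀ : ℕ, ∀ i, i₀ ≤ i → ¬ OddCleanedPointStepAt R P s p i) →
      Concl O A₀ t

/-- **(g′3′) glue PROVED: (Par-S) ⟸ hNS ∧ hARᵒ ∧ hK4′ ∧ hEv** (RULING 135b), by excluded middle on «odd cleaned-order point steps i.o.»; hNS enters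
ONLY as the antecedent of hK4′. Supersedes r40's `strippingTailSwitchingConclTwoN_of_parity`. OURS. [folklore] -/
theorem strippingTailSwitchingConclTwoN_of_parity' (hNS : NoCompanionSingularSurfaceTwoN)
    (hARo : StrippingTailSwitchingOddArithTwoN)
    (hK4' : NoCompanionSingularSurfaceTwoN → StrippingTailSwitchingArithConclTwoN)
    (hEv : StrippingTailSwitchingEvenConclTwoN) : StrippingTailSwitchingConclTwoN := by
  intro p hp2 k K _ _ _ _ _ O A₀ h₀ t core hrk R P s hR0 hN hrun hnd hhigh h2 hinf hwild hsw
  by_cases hodd : ∀ i₀ : ℕ, ∃ i, i₀ ≤ i ∧ OddCleanedPointStepAt R P s p i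
  · exact hK4' hNS p hp2 k K O A₀ h₀ t core hrk R P s hR0 hN hrun hnd hhigh h2 hinf hwild hsw
      (hARo p hp2 k K O A₀ h₀ t core hrk R P s hR0 hN hrun hnd hhigh h2 hinf hwild hsw hodd)
  · push Not at hodd
    obtain ⟨i₀, hi₀⟩ := hodd
    exact hEv p hp2 k K O A₀ h₀ t core hrk R P s hR0 hN hrun hnd hhigh h2 hinf hwild hsw ⟨i₀, hi₀⟩

/-- r40's glue (same name, same binder order) with the STRONG K4♯, for a prover who closes K4♯ outright. Pure logic. OURS. [folklore] -/
theorem strippingTailSwitchingConclTwoN_of_parity (hNS : NoCompanionSingularSurfaceTwoN)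
    (hARo : StrippingTailSwitchingOddArithTwoN) (hK4 : StrippingTailSwitchingArithConclTwoN)
    (hEv : StrippingTailSwitchingEvenConclTwoN) : StrippingTailSwitchingConclTwoN :=
  strippingTailSwitchingConclTwoN_of_parity' hNS hARo (fun _ => hK4) hEv

/-- **(g′4)** the un-cut ARITH-REDUCTION implies hARᵒ (pure logic; compatibility for consumers of (g2)). OURS. [folklore] -/
theorem strippingTailSwitchingOddArithTwoN_of_arith (hAR : StrippingTailSwitchingArithTwoN) :
    StrippingTailSwitchingOddArithTwoN :=
  fun p hp2 k K _ _ _ _ _ O A₀ h₀ t core hrk R P s hR0 hN hrun hnd hhigh h2 hinf hwild hsw _ =>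
    hAR p hp2 k K O A₀ h₀ t core hrk R P s hR0 hN hrun hnd hhigh h2 hinf hwild hsw

/-- **T-LINE CANDIDATE slate12'''' (r41; RULINGS 135b/137; the holder / plan-1 decide)** = `eternalSteeredRunTwo_of_slate11''''` with (Par-S) `hFBs` ↦
(g′3′) `hNS hARo hK4′ hEv`: 11 binders; FRONTIER {hB₂ᵗ, hC₂ᵗ, hK4′, hEv, hNS, hW3} · WORK {hG3 (direct), hNT4, hARᵒ} · FACTS {hL′, hCP′} — no rung, no node.
Pure logic. OURS. [folklore] -/
theorem eternalSteeredRunTwo_of_slate12''''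
    (hNT4 : ∀ e : ℕ, 2 ≤ e → NoTangentialStepPerfect 2 4 (2 * e))
    (hNS : NoCompanionSingularSurfaceTwoN) (hARo : StrippingTailSwitchingOddArithTwoN)
    (hK4' : NoCompanionSingularSurfaceTwoN → StrippingTailSwitchingArithConclTwoN) (hEv : StrippingTailSwitchingEvenConclTwoN)
    (hB₂ : BirthWanderHighConclTwoN) (hC₂ : BranchWanderHighConclTwoN)
    (hG3 : ∀ e : ℕ, 2 ≤ e → NoEternalConstOrderIsolatedChainPerfect 2 3 (2 * e))
    (hW3 : ∀ e : ℕ, 2 ≤ e → NoEternalConstOrderIsolatedChainImperfect 2 3 (2 * e))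
    (hL' : Literature.AlgebraicGeometry.Resolution.Lipman1978NoEternalNormalisedBranch.{0})
    (hCP' : Literature.AlgebraicGeometry.Resolution.CossartPiltant2019LocalPermissible.{0}) : EternalSteeredRunTwo :=
  eternalSteeredRunTwo_of_slate11'''' hNT4 (strippingTailSwitchingConclTwoN_of_parity' hNS hARo hK4' hEv) hB₂ hC₂ hG3 hW3 hL' hCP'

/-- r40's slate12''' (STRONG K4♯), kept as the special case `hK4′ := fun _ => hK4`. Pure logic. OURS. [folklore] -/
theorem eternalSteeredRunTwo_of_slate12'''
    (hNT4 : ∀ e : ℕ, 2 ≤ e → NoTangentialStepPerfect 2 4 (2 * e))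
    (hNS : NoCompanionSingularSurfaceTwoN) (hARo : StrippingTailSwitchingOddArithTwoN)
    (hK4 : StrippingTailSwitchingArithConclTwoN) (hEv : StrippingTailSwitchingEvenConclTwoN)
    (hB₂ : BirthWanderHighConclTwoN) (hC₂ : BranchWanderHighConclTwoN)
    (hG3 : ∀ e : ℕ, 2 ≤ e → NoEternalConstOrderIsolatedChainPerfect 2 3 (2 * e))
    (hW3 : ∀ e : ℕ, 2 ≤ e → NoEternalConstOrderIsolatedChainImperfect 2 3 (2 * e))
    (hL' : Literature.AlgebraicGeometry.Resolution.Lipman1978NoEternalNormalisedBranch.{0})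
    (hCP' : Literature.AlgebraicGeometry.Resolution.CossartPiltant2019LocalPermissible.{0}) : EternalSteeredRunTwo :=
  eternalSteeredRunTwo_of_slate12'''' hNT4 hNS hARo (fun _ => hK4) hEv hB₂ hC₂ hG3 hW3 hL' hCP'


-- Sigma29-geom-strat2.r43.delta.lean — res-L0-w41-strat-2 g2 (CRUX-STRATEGIST λ2; plan-1 RULINGS 144 (iii) / 152a (geom re-cut GO, coheight-one tightening ADOPTED) / 147a)
-- WHAT: the §σ2.29 r43 block = the c = 3 GEOMETRIC RE-CUT (hG3, hW3) ↦ hGW3 (G-geom with coheight one) + the currency-free height split (X) + new T-line slate13.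
-- HOW TO APPLY: INSERT the block below (from the line '/-! #### §σ2.29 r43' to the end of this file) VERBATIM immediately BEFORE the line 'end HeightSplitTwo'
--   of r42 OF RECORD 'L/res-L0-w41-lead-1/Steer_r42.lean' sha16 abfe507e31d3365c (r42 l.4804); APPEND-ONLY — no r42 line is edited (anchor-based: it applies
--   to any later base that keeps 'end HeightSplitTwo' and the names it cites). Result = 'r43/Steer_r43_geom.lean' sha16 1d151a2e31d542d3 (6231 l., 496 612 B;
--   block at l.4804–5233). Farm: rc 0 · 0 errors · 0 non-sorry warnings · 6 sorries = the six registered stubs (decl lines 254/305/1497/5981/6064/6072; stubs 4–6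
--   shifted +430 vs r42). check json 'r43/check_r43_geom.json' 439af69fc6b181f6. Generator 'r43/make_geom_block_r43.py' (python3 make_geom_block_r43.py <base> <out>).
-- WAITS FOR: res-D-pv-003's 152a engine theorem proving (W5) 'StrippedThreadTwoNHG' (same body, tree-side word) — until then hA3 is an explicit WORK binder
--   of slate13 (11 binders); when it lands, ONE more slate feeds hA3 by name (10 binders). Words file v2 'GeomChainWords.v2.lean' fa9d3e9ec7030c67 (rc 0).
-- OURS; candidates, not facts; counted 0. NOT the file of record (holder res-L0-w41-lead-1 registers after res-L0-w41-tri-2's splice audit).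

end SteeredTwo

end Summit.ResolutionOfSingularities.ResolutionOfSingularities.Theorems.SwitchingDichotomy.Words
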